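import Summits.CriticalPhenomena.PercolationContinuityZ3.Theorems.PercNearOneGluingNoHeavyLowerTailSahiCombFiveUpSetRankZ3
import Summits.CriticalPhenomena.PercolationContinuityZ3.Theorems.PercNearOneGluingNoHeavyLowerTailSahiCombTriWCertificate

/-!
# The two-copy certificate for `TRI_W(2)`: each of the three token classes is independent in ONE copy, and the split (matroid-union) bridge

Support file of the one-cut programme (crux `NoHeavyLowerTail`, stmt-CriticalPhenomena-4575; TRI lane of cell `prim-masterthm`; seat prim-lf-1 gen 25;
memo `FROM-prim-lf-1-gen25-GF2-NOGO-AND-MATROID.md` §0(e),(f), §3).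

The certificate of `…SahiCombTriWCertificate` (`certRow`, target `CertSigmaKernelZero` / `CertKernelZero`) has three token classes at each index
`x` of the square `{0, p, q, 1}` (F-index gauge): `L_x = F_x ∩ refl(G_x̄)` (tree `D2`), `R_x = G_x̄ ∩ refl(F_x)` (`D1`) and `K_x = refl(F_x ∩ G_x)`
(`D3`), a token at `x` being seen by the supply fibres `U_y = F_y ∩ G_y`, `y ⊇ x`, through the zeta kernel `[d ⊆ t]`.  With TOKEN-dependent weights
(`certRowTok`) the certificate exists iff the tokens split into two families that are each independent in the ONE-copy inclusion system plus a
tag-matched family of `K`-tokens (memo §0(e): multilinearity of a maximal minor; by Edmonds–Nash-Williams this is the matroid-union inequality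
(MU) `|Y| ≤ 2·r₁(Y) + r_T(Y ∩ K)`, census-clean for `a ≤ 3`).  This file proves the three facts such a split is built from, and the bridge:

* **`classK_kernel_eq_zero`** — the `K`-tokens alone are one-copy independent (all four levels jointly; fibrewise C1, bottom-up — in fact they
  form a BASIS of `ℚ^𝒰`, memo §3(K));
* **`classL_kernel_eq_zero`** — the `L`-tokens alone are one-copy independent (C2′ in the big cube `X × W`, done fibrewise: extend the four
  levelled equations from `F_y ∩ G_y` to `G_y` by point support, kill `L_1` on `G₀`, then `L_p`, `L_q`, then `L_0`);
* **`classR_kernel_eq_zero`** — the `R`-tokens alone are one-copy independent (pointwise solve in the `G`-type of `t` + C2′, bottom-up);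
* `oneCopyRow`, `tagRow` — the one-copy inclusion rows and the local `T4` tag rows on the tree's index types `CertRowIdx` / supply / tag columns;
* **`triW_nonneg_of_split`** — if the demand tokens split as `σ : CertRowIdx → Fin 3` with the one-copy rows independent on `σ⁻¹ 0` and on
  `σ⁻¹ 1` and the tag rows independent on `σ⁻¹ 2`, then `0 ≤ triW P F G` (pure counting: `|σ⁻¹ c| ≤ #columns of that block`);
* `SplitCert` (`@[conjecture]`, = (MU), the weakest two-copy statement; census memo §0(e)) and **`triWIneq_of_splitCert : SplitCert → TriWIneq`**.
The three class theorems are stated, like `sigma3_kernel_eq_zero`, for the square presented by eight up-sets `F₀ ⊆ Fp, Fq ⊆ F₁`, `G₀ ⊆ Gp, Gq ⊆ G₁`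
at `P = univ` (free `P`-restriction, `rankZ_kernel_eq_zero_of_upperSet`, transports them to every up-set `P`).
HONEST LABEL: three unconditional kernel theorems about ONE class each + a counting bridge + a typed conjecture.  Unions of classes are NOT
one-copy independent (memo §0(f): `L ∪ R` fails on 11,805 / 28,224 instances at `(n,a) = (2,2)`), and neither `SplitCert` nor `TriWIneq` is proved
here.  Also recorded in the memo: the explicit 0/1 table Σ is NOT full rank over `GF(2)` (720 of 57,471,561 `(3,2)` instances), so no parity
argument can prove `CertSigmaKernelZero`. [this work]
-/

namespace Summit.CriticalPhenomena.PercolationContinuityZ3.Theorems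

namespace FiveUpSet

open Finset

variable {α : Type} [DecidableEq α] [Fintype α]

/-! ### Small helpers on `zsum` -/

/-- The zeta combination of the zero vector vanishes. [this work] -/
theorem zsum_eq_zero_of_forall_eq_zero (f : Finset α → ℚ) (hf : ∀ d, f d = 0) (t : Finset α) : zsum f t = 0 := by
  unfold zsum
  exact Finset.sum_eq_zero fun d _ => by rw [hf d, zero_mul]

omit [Fintype α] in
/-- The intersection of two up-sets (as finsets of the cube) is an up-set. [this work] -/
theorem isUpperSet_inter {A B : Finset (Finset α)} (hA : IsUpperSet (A : Set (Finset α))) (hB : IsUpperSet (B : Set (Finset α))) :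
    IsUpperSet ((A ∩ B : Finset (Finset α)) : Set (Finset α)) := by
  rw [coe_inter]; exact hA.inter hB

/-- C1 in `zsum` form on an intersection: if `k` lives on `{d : dᶜ ∈ A ∩ B}` (`A, B` up-sets) and `zsum k` vanishes on `A ∩ B`, then `k = 0`. [this work] -/
theorem eq_zero_of_zsum_eq_zero_inter {A B : Finset (Finset α)} (hA : IsUpperSet (A : Set (Finset α)))
    (hB : IsUpperSet (B : Set (Finset α))) (k : Finset α → ℚ) (hk : ∀ d, k d ≠ 0 → dᶜ ∈ A ∧ dᶜ ∈ B)
    (h : ∀ t, t ∈ A → t ∈ B → zsum k t = 0) : ∀ d, k d = 0 := by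
  refine eq_zero_of_zeta_sum_eq_zero (isUpperSet_inter hA hB) k (fun d hd => mem_inter.2 (hk d hd)) ?_
  intro t ht
  have h' := h t (mem_inter.1 ht).1 (mem_inter.1 ht).2
  unfold zsum at h'
  exact h'

/-! ### The K-class alone: one-copy independent (fibrewise antipodal basis) -/

/-- **The `K`-tokens are one-copy independent.**  Eight up-sets `F₀ ⊆ Fp, Fq ⊆ F₁`, `G₀ ⊆ Gp, Gq ⊆ G₁` (only the up-set property is used);
coefficient vectors `k0, kp, kq, k1` on `refl(F₀ ∩ G₀)`, `refl(Fp ∩ Gp)`, `refl(Fq ∩ Gq)`, `refl(F₁ ∩ G₁)` (the classes `K_0, K_p, K_q, K_1`); the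
ONE-copy levelled equations — fibre `0` (`t ∈ F₀ ∩ G₀`): `Z k0 = 0`; fibre `p`: `Z k0 + Z kp = 0`; fibre `q`: `Z k0 + Z kq = 0`; top fibre:
`Z k0 + Z kp + Z kq + Z k1 = 0` — force all four to vanish.  Proof: C1 on `F₀ ∩ G₀` kills `k0`, then C1 on `Fp ∩ Gp` kills `kp`, etc.
(Counting shows the `K`-rows are in fact a basis of `ℚ^𝒰`.) [this work] -/
theorem classK_kernel_eq_zero (F₀ Fp Fq F₁ G₀ Gp Gq G₁ : Finset (Finset α))
    (hF₀ : IsUpperSet (F₀ : Set (Finset α))) (hFp : IsUpperSet (Fp : Set (Finset α))) (hFq : IsUpperSet (Fq : Set (Finset α)))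
    (hF₁ : IsUpperSet (F₁ : Set (Finset α))) (hG₀ : IsUpperSet (G₀ : Set (Finset α))) (hGp : IsUpperSet (Gp : Set (Finset α)))
    (hGq : IsUpperSet (Gq : Set (Finset α))) (hG₁ : IsUpperSet (G₁ : Set (Finset α)))
    (k0 kp kq k1 : Finset α → ℚ)
    (sk0 : ∀ d, k0 d ≠ 0 → dᶜ ∈ F₀ ∧ dᶜ ∈ G₀) (skp : ∀ d, kp d ≠ 0 → dᶜ ∈ Fp ∧ dᶜ ∈ Gp)
    (skq : ∀ d, kq d ≠ 0 → dᶜ ∈ Fq ∧ dᶜ ∈ Gq) (sk1 : ∀ d, k1 d ≠ 0 → dᶜ ∈ F₁ ∧ dᶜ ∈ G₁)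
    (e0 : ∀ t, t ∈ F₀ → t ∈ G₀ → zsum k0 t = 0)
    (ep : ∀ t, t ∈ Fp → t ∈ Gp → zsum k0 t + zsum kp t = 0)
    (eq_ : ∀ t, t ∈ Fq → t ∈ Gq → zsum k0 t + zsum kq t = 0)
    (e1 : ∀ t, t ∈ F₁ → t ∈ G₁ → zsum k0 t + zsum kp t + zsum kq t + zsum k1 t = 0) :
    (∀ d, k0 d = 0) ∧ (∀ d, kp d = 0) ∧ (∀ d, kq d = 0) ∧ (∀ d, k1 d = 0) := by
  have hk0 : ∀ d, k0 d = 0 := eq_zero_of_zsum_eq_zero_inter hF₀ hG₀ k0 sk0 e0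
  have z0 : ∀ t, zsum k0 t = 0 := zsum_eq_zero_of_forall_eq_zero k0 hk0
  have hkp : ∀ d, kp d = 0 := by
    refine eq_zero_of_zsum_eq_zero_inter hFp hGp kp skp fun t htF htG => ?_
    have h := ep t htF htG
    rw [z0 t, zero_add] at h
    exact h
  have hkq : ∀ d, kq d = 0 := by
    refine eq_zero_of_zsum_eq_zero_inter hFq hGq kq skq fun t htF htG => ?_
    have h := eq_ t htF htG
    rw [z0 t, zero_add] at h
    exact h
  have zp : ∀ t, zsum kp t = 0 := zsum_eq_zero_of_forall_eq_zero kp hkp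
  have zq : ∀ t, zsum kq t = 0 := zsum_eq_zero_of_forall_eq_zero kq hkq
  have hk1 : ∀ d, k1 d = 0 := by
    refine eq_zero_of_zsum_eq_zero_inter hF₁ hG₁ k1 sk1 fun t htF htG => ?_
    have h := e1 t htF htG
    rw [z0 t, zp t, zq t, zero_add, zero_add, zero_add] at h
    exact h
  exact ⟨hk0, hkp, hkq, hk1⟩

/-! ### The L-class alone: one-copy independent (C2′ in the big cube, fibrewise) -/

/-- **The `L`-tokens are one-copy independent.**  Eight up-sets `F₀ ⊆ Fp, Fq ⊆ F₁`, `G₀ ⊆ Gp, Gq ⊆ G₁`; coefficient vectors `b0` on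
`F₀ ∩ refl G₁`, `bp` on `Fp ∩ refl Gq`, `bq` on `Fq ∩ refl Gp`, `b1` on `F₁ ∩ refl G₀` (the classes `L_0, L_p, L_q, L_1`); the one-copy
levelled equations — fibre `0` (`t ∈ F₀ ∩ G₀`): `Z b0 = 0`; fibre `p` (`t ∈ Fp ∩ Gp`): `Z b0 + Z bp = 0`; fibre `q`: `Z b0 + Z bq = 0`; top
fibre (`t ∈ F₁ ∩ G₁`): `Z b0 + Z bp + Z bq + Z b1 = 0` — force all four to vanish.  Proof: by point support the equations hold on the whole
`G`-fibres; on `G₀` all four hold, so `Z b1 = 0` on `G₀` and C2′ kills `b1`; on `Gq` the top and `q` equations give `Z bp = 0`, C2′ kills `bp`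
(and `bq` alike); finally `Z b0 = 0` on `G₁` kills `b0`. [this work] -/
theorem classL_kernel_eq_zero (F₀ Fp Fq F₁ G₀ Gp Gq G₁ : Finset (Finset α))
    (hF₀ : IsUpperSet (F₀ : Set (Finset α))) (hFp : IsUpperSet (Fp : Set (Finset α))) (hFq : IsUpperSet (Fq : Set (Finset α)))
    (hF₁ : IsUpperSet (F₁ : Set (Finset α))) (hG₀ : IsUpperSet (G₀ : Set (Finset α))) (hGp : IsUpperSet (Gp : Set (Finset α)))
    (hGq : IsUpperSet (Gq : Set (Finset α))) (hG₁ : IsUpperSet (G₁ : Set (Finset α)))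
    (hF0p : F₀ ⊆ Fp) (hF0q : F₀ ⊆ Fq) (hFp1 : Fp ⊆ F₁) (hFq1 : Fq ⊆ F₁)
    (hG0p : G₀ ⊆ Gp) (hG0q : G₀ ⊆ Gq) (hGp1 : Gp ⊆ G₁) (hGq1 : Gq ⊆ G₁)
    (b0 bp bq b1 : Finset α → ℚ)
    (sb0 : ∀ d, b0 d ≠ 0 → d ∈ F₀ ∧ dᶜ ∈ G₁) (sbp : ∀ d, bp d ≠ 0 → d ∈ Fp ∧ dᶜ ∈ Gq)
    (sbq : ∀ d, bq d ≠ 0 → d ∈ Fq ∧ dᶜ ∈ Gp) (sb1 : ∀ d, b1 d ≠ 0 → d ∈ F₁ ∧ dᶜ ∈ G₀)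
    (e0 : ∀ t, t ∈ F₀ → t ∈ G₀ → zsum b0 t = 0)
    (ep : ∀ t, t ∈ Fp → t ∈ Gp → zsum b0 t + zsum bp t = 0)
    (eq_ : ∀ t, t ∈ Fq → t ∈ Gq → zsum b0 t + zsum bq t = 0)
    (e1 : ∀ t, t ∈ F₁ → t ∈ G₁ → zsum b0 t + zsum bp t + zsum bq t + zsum b1 t = 0) :
    (∀ d, b0 d = 0) ∧ (∀ d, bp d = 0) ∧ (∀ d, bq d = 0) ∧ (∀ d, b1 d = 0) := by
  -- point supports: each `Z b_x` vanishes off `F_x`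
  have n0 : ∀ t, t ∉ F₀ → zsum b0 t = 0 := fun t ht => zsum_eq_zero_of_not_mem hF₀ b0 (fun d hd => (sb0 d hd).1) ht
  have np : ∀ t, t ∉ Fp → zsum bp t = 0 := fun t ht => zsum_eq_zero_of_not_mem hFp bp (fun d hd => (sbp d hd).1) ht
  have nq : ∀ t, t ∉ Fq → zsum bq t = 0 := fun t ht => zsum_eq_zero_of_not_mem hFq bq (fun d hd => (sbq d hd).1) ht
  have n1 : ∀ t, t ∉ F₁ → zsum b1 t = 0 := fun t ht => zsum_eq_zero_of_not_mem hF₁ b1 (fun d hd => (sb1 d hd).1) ht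
  -- the equations extended to the whole G-fibres
  have E0 : ∀ t, t ∈ G₀ → zsum b0 t = 0 := by
    intro t htG
    by_cases htF : t ∈ F₀
    · exact e0 t htF htG
    · exact n0 t htF
  have Ep : ∀ t, t ∈ Gp → zsum b0 t + zsum bp t = 0 := by
    intro t htG
    by_cases htF : t ∈ Fp
    · exact ep t htF htG
    · rw [n0 t (fun h => htF (hF0p h)), np t htF, add_zero]
  have Eq : ∀ t, t ∈ Gq → zsum b0 t + zsum bq t = 0 := by
    intro t htG
    by_cases htF : t ∈ Fq
    · exact eq_ t htF htG
    · rw [n0 t (fun h => htF (hF0q h)), nq t htF, add_zero]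
  have E1 : ∀ t, t ∈ G₁ → zsum b0 t + zsum bp t + zsum bq t + zsum b1 t = 0 := by
    intro t htG
    by_cases htF : t ∈ F₁
    · exact e1 t htF htG
    · rw [n0 t (fun h => htF (hFp1 (hF0p h))), np t (fun h => htF (hFp1 h)), nq t (fun h => htF (hFq1 h)), n1 t htF]
      ring
  -- Step 1: `b1 = 0` (all equations hold on `G₀`)
  have hb1 : ∀ d, b1 d = 0 := by
    refine eq_zero_of_zsum_eq_zero_on hF₁ hG₀ b1 sb1 fun t _ htG => ?_
    have h0 := E0 t htG
    have hp := Ep t (hG0p htG)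
    have hq := Eq t (hG0q htG)
    have h1 := E1 t (hGp1 (hG0p htG))
    linarith
  have z1 : ∀ t, zsum b1 t = 0 := zsum_eq_zero_of_forall_eq_zero b1 hb1
  -- Step 2: `bp = 0` (on `Gq`: top minus `q`), `bq = 0` (on `Gp`: top minus `p`)
  have hbp : ∀ d, bp d = 0 := by
    refine eq_zero_of_zsum_eq_zero_on hFp hGq bp sbp fun t _ htG => ?_
    have hq := Eq t htG
    have h1 := E1 t (hGq1 htG)
    rw [z1 t] at h1
    linarith
  have hbq : ∀ d, bq d = 0 := by
    refine eq_zero_of_zsum_eq_zero_on hFq hGp bq sbq fun t _ htG => ?_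
    have hp := Ep t htG
    have h1 := E1 t (hGp1 htG)
    rw [z1 t] at h1
    linarith
  have zp : ∀ t, zsum bp t = 0 := zsum_eq_zero_of_forall_eq_zero bp hbp
  have zq : ∀ t, zsum bq t = 0 := zsum_eq_zero_of_forall_eq_zero bq hbq
  -- Step 3: `b0 = 0` (top equation on `G₁`)
  have hb0 : ∀ d, b0 d = 0 := by
    refine eq_zero_of_zsum_eq_zero_on hF₀ hG₁ b0 sb0 fun t _ htG => ?_
    have h1 := E1 t htG
    rw [z1 t, zp t, zq t] at h1
    linarith
  exact ⟨hb0, hbp, hbq, hb1⟩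

/-! ### The R-class alone: one-copy independent (pointwise solve in the G-type + C2′) -/

/-- **The `R`-tokens are one-copy independent.**  Eight up-sets `F₀ ⊆ Fp, Fq ⊆ F₁`, `G₀ ⊆ Gp, Gq ⊆ G₁`; coefficient vectors named by their
`G`-index as in `sigma3_kernel_eq_zero`: `g1` on `G₁ ∩ refl F₀` (`R_0`, level `0`), `gq` on `Gq ∩ refl Fp` (`R_p`, level `p`), `gp` on
`Gp ∩ refl Fq` (`R_q`), `g0` on `G₀ ∩ refl F₁` (`R_1`, top); one-copy levelled equations — fibre `0` (`t ∈ F₀ ∩ G₀`): `Z g1 = 0`; fibre `p`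
(`t ∈ Fp ∩ Gp`): `Z g1 + Z gq = 0`; fibre `q`: `Z g1 + Z gp = 0`; top fibre: `Z g1 + Z gq + Z gp + Z g0 = 0` — force all four to vanish.
Proof: for `t ∈ F₀ ∩ G₁` a case analysis on `t ∈ Gp`, `t ∈ Gq`, `t ∈ G₀` (point supports kill the absent classes) gives `Z g1 t = 0`, so C2′
kills `g1`; then `gq`, `gp` on `Fp ∩ Gq`, `Fq ∩ Gp`; then `g0`.  The case `t ∈ Gp ∩ Gq ∖ G₀` is the one place with a genuine cancellation
(`Z gq = Z gp = −Z g1` and the top equation give `−Z g1 = 0`). [this work] -/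
theorem classR_kernel_eq_zero (F₀ Fp Fq F₁ G₀ Gp Gq G₁ : Finset (Finset α))
    (hF₀ : IsUpperSet (F₀ : Set (Finset α))) (hFp : IsUpperSet (Fp : Set (Finset α))) (hFq : IsUpperSet (Fq : Set (Finset α)))
    (hF₁ : IsUpperSet (F₁ : Set (Finset α))) (hG₀ : IsUpperSet (G₀ : Set (Finset α))) (hGp : IsUpperSet (Gp : Set (Finset α)))
    (hGq : IsUpperSet (Gq : Set (Finset α))) (hG₁ : IsUpperSet (G₁ : Set (Finset α)))
    (hF0p : F₀ ⊆ Fp) (hF0q : F₀ ⊆ Fq) (hFp1 : Fp ⊆ F₁) (hFq1 : Fq ⊆ F₁)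
    (hG0p : G₀ ⊆ Gp) (hG0q : G₀ ⊆ Gq) (hGp1 : Gp ⊆ G₁) (hGq1 : Gq ⊆ G₁)
    (g1 gq gp g0 : Finset α → ℚ)
    (sg1 : ∀ d, g1 d ≠ 0 → d ∈ G₁ ∧ dᶜ ∈ F₀) (sgq : ∀ d, gq d ≠ 0 → d ∈ Gq ∧ dᶜ ∈ Fp)
    (sgp : ∀ d, gp d ≠ 0 → d ∈ Gp ∧ dᶜ ∈ Fq) (sg0 : ∀ d, g0 d ≠ 0 → d ∈ G₀ ∧ dᶜ ∈ F₁)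
    (e0 : ∀ t, t ∈ F₀ → t ∈ G₀ → zsum g1 t = 0)
    (ep : ∀ t, t ∈ Fp → t ∈ Gp → zsum g1 t + zsum gq t = 0)
    (eq_ : ∀ t, t ∈ Fq → t ∈ Gq → zsum g1 t + zsum gp t = 0)
    (e1 : ∀ t, t ∈ F₁ → t ∈ G₁ → zsum g1 t + zsum gq t + zsum gp t + zsum g0 t = 0) :
    (∀ d, g1 d = 0) ∧ (∀ d, gq d = 0) ∧ (∀ d, gp d = 0) ∧ (∀ d, g0 d = 0) := by
  -- point supports: `Z g_` vanishes off its `G`-set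
  have nq : ∀ t, t ∉ Gq → zsum gq t = 0 := fun t ht => zsum_eq_zero_of_not_mem hGq gq (fun d hd => (sgq d hd).1) ht
  have np : ∀ t, t ∉ Gp → zsum gp t = 0 := fun t ht => zsum_eq_zero_of_not_mem hGp gp (fun d hd => (sgp d hd).1) ht
  have n0 : ∀ t, t ∉ G₀ → zsum g0 t = 0 := fun t ht => zsum_eq_zero_of_not_mem hG₀ g0 (fun d hd => (sg0 d hd).1) ht
  -- Step 1: `g1 = 0`
  have hg1 : ∀ d, g1 d = 0 := by
    refine eq_zero_of_zsum_eq_zero_on hG₁ hF₀ g1 sg1 fun t htG htF => ?_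
    by_cases htp : t ∈ Gp
    · by_cases htq : t ∈ Gq
      · by_cases ht0 : t ∈ G₀
        · exact e0 t htF ht0
        · have hp := ep t (hF0p htF) htp
          have hq := eq_ t (hF0q htF) htq
          have h1 := e1 t (hFp1 (hF0p htF)) htG
          rw [n0 t ht0] at h1
          linarith
      · have hp := ep t (hF0p htF) htp
        rw [nq t htq] at hp
        linarith
    · by_cases htq : t ∈ Gq
      · have hq := eq_ t (hF0q htF) htq
        rw [np t htp] at hq
        linarith
      · have h1 := e1 t (hFp1 (hF0p htF)) htG
        rw [nq t htq, np t htp, n0 t (fun h => htp (hG0p h))] at h1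
        linarith
  have z1 : ∀ t, zsum g1 t = 0 := zsum_eq_zero_of_forall_eq_zero g1 hg1
  -- Step 2: `gq = 0` on `Gq ∩ Fp`, `gp = 0` on `Gp ∩ Fq`
  have hgq : ∀ d, gq d = 0 := by
    refine eq_zero_of_zsum_eq_zero_on hGq hFp gq sgq fun t htG htF => ?_
    by_cases htp : t ∈ Gp
    · have hp := ep t htF htp
      rw [z1 t] at hp
      linarith
    · have h1 := e1 t (hFp1 htF) (hGq1 htG)
      rw [z1 t, np t htp, n0 t (fun h => htp (hG0p h))] at h1
      linarith
  have hgp : ∀ d, gp d = 0 := by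
    refine eq_zero_of_zsum_eq_zero_on hGp hFq gp sgp fun t htG htF => ?_
    by_cases htq : t ∈ Gq
    · have hq := eq_ t htF htq
      rw [z1 t] at hq
      linarith
    · have h1 := e1 t (hFq1 htF) (hGp1 htG)
      rw [z1 t, nq t htq, n0 t (fun h => htq (hG0q h))] at h1
      linarith
  have zq : ∀ t, zsum gq t = 0 := zsum_eq_zero_of_forall_eq_zero gq hgq
  have zp : ∀ t, zsum gp t = 0 := zsum_eq_zero_of_forall_eq_zero gp hgp
  -- Step 3: `g0 = 0`
  have hg0 : ∀ d, g0 d = 0 := by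
    refine eq_zero_of_zsum_eq_zero_on hG₀ hF₁ g0 sg0 fun t htG htF => ?_
    have h1 := e1 t htF (hGp1 (hG0p htG))
    rw [z1 t, zq t, zp t] at h1
    linarith
  exact ⟨hg1, hgq, hgp, hg0⟩

/-! ### The split (matroid-union) bridge on the tree's index types -/

variable {β γ : Type} [DecidableEq β] [Fintype β] [DecidableEq γ] [Fintype γ]

/-- Supply columns of ONE copy: `⊔_y P ∩ F y ∩ G y`. [this work] -/
abbrev OneCopyColIdx (P : Finset (Finset γ)) (F G : Finset β → Finset (Finset γ)) : Type :=
  Σ y : Finset β, ↥(P ∩ F y ∩ G y)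

/-- Tag columns: `⊔_x₀ P ∩ refl (F x₀) ∩ refl (G x₀ᶜ)` (the `T4` classes). [this work] -/
abbrev TagColIdx (P : Finset (Finset γ)) (F G : Finset β → Finset (Finset γ)) : Type :=
  Σ x₀ : Finset β, ↥(P ∩ refl (F x₀) ∩ refl (G x₀ᶜ))

/-- The ONE-copy inclusion row of a demand token (all three classes alike): entry `[x ⊆ y][d ⊆ t]` at the supply column `(y,t)`. [this work] -/
def oneCopyRow (P : Finset (Finset γ)) (F G : Finset β → Finset (Finset γ)) : CertRowIdx P F G → OneCopyColIdx P F G → ℚ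
  | ⟨x, Sum.inl d⟩, ⟨y, t⟩ => if x ⊆ y ∧ (d : Finset γ) ⊆ (t : Finset γ) then 1 else 0
  | ⟨x, Sum.inr (Sum.inl d)⟩, ⟨y, t⟩ => if x ⊆ y ∧ (d : Finset γ) ⊆ (t : Finset γ) then 1 else 0
  | ⟨x, Sum.inr (Sum.inr d)⟩, ⟨y, t⟩ => if x ⊆ y ∧ (d : Finset γ) ⊆ (t : Finset γ) then 1 else 0

/-- The local tag row of a demand token: a `K`-token (`D3`) of class `x` at the point `d` has entry `[x₀ ⊆ x][e = d]` at the tag column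
`(x₀, e)`; `L`/`R` tokens have no tags. [this work] -/
def tagRow (P : Finset (Finset γ)) (F G : Finset β → Finset (Finset γ)) : CertRowIdx P F G → TagColIdx P F G → ℚ
  | ⟨_, Sum.inl _⟩, _ => 0
  | ⟨_, Sum.inr (Sum.inl _)⟩, _ => 0
  | ⟨x, Sum.inr (Sum.inr d)⟩, ⟨x₀, e⟩ => if x₀ ⊆ x ∧ (e : Finset γ) = (d : Finset γ) then 1 else 0

/-- Counting: `#CertColIdx = 2 · #OneCopyColIdx + #TagColIdx`. [this work] -/
theorem card_certColIdx_eq (P : Finset (Finset γ)) (F G : Finset β → Finset (Finset γ)) :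
    Fintype.card (CertColIdx P F G) = 2 * Fintype.card (OneCopyColIdx P F G) + Fintype.card (TagColIdx P F G) := by
  rw [Fintype.card_sum, Fintype.card_prod, Fintype.card_fin]
  ring

/-- **The split bridge.**  If the demand tokens are split by `σ : CertRowIdx P F G → Fin 3` so that the one-copy rows of the tokens with
`σ = 0` are linearly independent, those with `σ = 1` are linearly independent, and the tag rows of the tokens with `σ = 2` are linearly
independent, then `0 ≤ triW P F G`.  Proof: each independent family is at most as large as its column set, so `#rows ≤ 2·#supply + #tags =
#columns`, and `triW = #columns − #rows` (`triW_eq_card_sub_card`).  (Equivalently: token-dependent 0/1 directions in `certRowTok`; by matroid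
union the existence of such a split is the inequality (MU) of the memo.) [this work] -/
theorem triW_nonneg_of_split (P : Finset (Finset γ)) (F G : Finset β → Finset (Finset γ)) (σ : CertRowIdx P F G → Fin 3)
    (h0 : LinearIndependent ℚ (fun i : {i : CertRowIdx P F G // σ i = 0} => oneCopyRow P F G i.1))
    (h1 : LinearIndependent ℚ (fun i : {i : CertRowIdx P F G // σ i = 1} => oneCopyRow P F G i.1))
    (h2 : LinearIndependent ℚ (fun i : {i : CertRowIdx P F G // σ i = 2} => tagRow P F G i.1)) :
    0 ≤ triW P F G := by
  have c0 := h0.fintype_card_le_finrank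
  have c1 := h1.fintype_card_le_finrank
  have c2 := h2.fintype_card_le_finrank
  rw [Module.finrank_fintype_fun_eq_card] at c0 c1 c2
  have hrows : Fintype.card (CertRowIdx P F G) = ∑ c : Fin 3, Fintype.card {i : CertRowIdx P F G // σ i = c} := by
    rw [← Fintype.card_congr (Equiv.sigmaFiberEquiv σ), Fintype.card_sigma]
  rw [Fin.sum_univ_three] at hrows
  have hcols := card_certColIdx_eq P F G
  have hle : Fintype.card (CertRowIdx P F G) ≤ Fintype.card (CertColIdx P F G) := by
    rw [hrows, hcols]; omega
  have hle' : (Fintype.card (CertRowIdx P F G) : ℤ) ≤ Fintype.card (CertColIdx P F G) := by exact_mod_cast hle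
  rw [triW_eq_card_sub_card]
  omega

/-- **(MU) / split form of the two-copy certificate** (CONJECTURE — an obligation of our theory, never a fact; the weakest form of the method,
memo §0(e)): for every pair of finite cubes, up-set `P` and monotone up-set families `F, G`, the demand tokens split into two families whose
ONE-copy inclusion rows are independent and a third family of `K`-tokens whose local tag rows are independent.  Equivalent to the existence of
token weights in `certRowTok`, and (Edmonds–Nash-Williams) to `|Y| ≤ 2·r₁(Y) + r_T(Y ∩ K)` for every token set `Y`.  Census: exhaustive
`(n,a) = (1,1),(2,1),(3,1),(2,2)`, sampled `(4,1),(3,2),(2,3),(4,2),(3,3)` — 0 failures.  OPEN. [this work] -/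
@[conjecture] def SplitCert : Prop :=
  ∀ (β γ : Type) [DecidableEq β] [Fintype β] [DecidableEq γ] [Fintype γ]
    (P : Finset (Finset γ)) (F G : Finset β → Finset (Finset γ)),
    IsUpperSet (P : Set (Finset γ)) → (∀ x, IsUpperSet (F x : Set (Finset γ))) → (∀ x, IsUpperSet (G x : Set (Finset γ))) →
    Monotone F → Monotone G →
    ∃ σ : CertRowIdx P F G → Fin 3,
      LinearIndependent ℚ (fun i : {i : CertRowIdx P F G // σ i = 0} => oneCopyRow P F G i.1) ∧
      LinearIndependent ℚ (fun i : {i : CertRowIdx P F G // σ i = 1} => oneCopyRow P F G i.1) ∧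
      LinearIndependent ℚ (fun i : {i : CertRowIdx P F G // σ i = 2} => tagRow P F G i.1)

/-- `SplitCert → TriWIneq`: the split form implies `TRI_W(a) ≥ 0` for every `a`. [this work] -/
theorem triWIneq_of_splitCert (h : SplitCert) : TriWIneq := by
  intro β γ _ _ _ _ P F G hP hF hG hFm hGm
  obtain ⟨σ, h0, h1, h2⟩ := h β γ P F G hP hF hG hFm hGm
  exact triW_nonneg_of_split P F G σ h0 h1 h2

end FiveUpSet

end Summit.CriticalPhenomena.PercolationContinuityZ3.Theorems
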